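import Mathlib
import Summits.ValiantsHypothesis.ValiantsHypothesis.Theorems.FifoMatchingNNLinearDegreeCofactorHardWordPrefixCounts
import HarnessLib

/-!
# Crux `NNLinearDegreeCofactorHard` (stmt-ValiantsHypothesis-23918), line `internal_cofactor`, stub S2b (ii):
# the inflated queue word — BALANCE, the BALLOT property and the support in 𝓕_R (unit (A″), part 4)

For the word `InflateWord.inflateWord R L m y` (SPEC `Lines/internal_cofactor-S2b-SPEC.md` S1/S5/S6):

* (generic counts `isBallot_of_prefix_le`, `height_eq_sum_letters`, `card_openers_lt_add` are in `…WordPrefixCounts.lean`);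
* the tail start: `vrank_tailStart`, `tailHeight_eq` (the definition `tailHeight` IS the height at `E′`),
  `tailHeight_eq_sum`, `card_compl_filter_tailStart_le` (`T_V = #Rᶜ − 2jE` tail non-defect letters),
  `card_tail_positions` (`T_V + #(R ∩ [E′,N)) = N − E′`), `vrank_add_card_lt`, `card_R_split`;
* the drain (S5): `two_mul_tailPushes_eq` — if `N` is even and `#(R ∩ [E′,N)) ≤ h(E′) ≤ T_V + #(R ∩ [E′,N))` then
  `2·tailPushes = T_V + #(R ∩ [E′,N)) − h(E′)` and `tailPushes ≤ T_V` (parity from the height parity);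
* `balanced_inflateWord` — then `#closers = #openers` (the word ends at height `0`);
* `prefix_le_inflateWord` — if moreover the head satisfies `2·#(R ∩ [0,u)) ≤ u` (`u ≤ A`, SPEC S0) and the middle
  prefixes `[A, E′]` have `#closers ≤ #openers` (what the Band gives), then EVERY prefix does (head: all non-defect
  letters push; tail: push phase `≥ h(E′) − #R_tail ≥ 0`, pop phase `= #{positions ≥ u} ≥ 0`);
* `isBallot_inflateWord`, `fifo_inflateWord_mem` — hence the FIFO pairing is a nest-free perfect matching avoiding
  `R × R`: the measure of the SPEC is supported on `𝓕_R` (p3's `AvoidingSpread` interface).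

Honest framing: bookkeeping for ONE unit of an OPEN stub's measure construction (target of record since ruling
01:33:43Z: the exponent-2 rung S11; the ∀c crux stays open); nothing here proves S2b, S11, the crux, `NNDivisionHard`,
`NNNotVP` or VP ≠ VNP.  No definitions, no named facts.
-/

noncomputable section

-- Sub = Summit single-conjunct layout: the duplicated namespace component is mandated by the tree.
set_option linter.dupNamespace false

namespace Summit.ValiantsHypothesis.ValiantsHypothesis.Theorems.FifoMatching.NNLinearDegreeCofactorHard.InflateWord

open Finset Literature.Computability.AlgebraicComplexity
open Summit.ValiantsHypothesis.ValiantsHypothesis.Theorems.FifoMatching.NNMonotoneHard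


/-! ### The inflated word: the height at the tail start, balance -/

section Inflate

variable {N : ℕ} (R : Finset (Fin N)) (L m : ℕ) (y : Fin (2 * (Rᶜ.card / 2)) → Bool)

/-- The V-rank of the tail start is `2·jE`. [folklore] -/
theorem vrank_tailStart : vrank R (tailStart R L m) = 2 * tailPairs R L m := by
  unfold tailStart
  rcases (two_mul_tailPairs_le R L m).eq_or_lt with h | h
  · rw [vpos_of_le R h.ge, vrank_of_le R le_rfl, h]
  · exact vrank_vpos R h

/-- **`tailHeight` is the height of the word at the tail start `E′`.** [folklore] -/
theorem tailHeight_eq :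
    tailHeight R L m y
      = (((openerSet (inflateWord R L m y)).filter fun i => i.val < tailStart R L m).card : ℤ)
        - (((closerSet (inflateWord R L m y)).filter fun i => i.val < tailStart R L m).card : ℤ) := by
  rw [height_eq_sum_letters _ _ (tailStart_le R L m)]
  unfold tailHeight
  refine sum_congr rfl fun t ht => ?_
  rw [mem_filter] at ht
  by_cases htR : t ∈ R
  · rw [if_neg (fun h => h.1 htR), inflateWord_apply_of_mem R L m y htR]
    simp
  · have hvr : vrank R t < 2 * tailPairs R L m := by
      have h1 := vrank_succ R t
      rw [if_neg htR] at h1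
      have h2 := vrank_mono R (Nat.succ_le_of_lt ht.2)
      rw [h1, vrank_tailStart] at h2
      omega
    rw [inflateWord_apply_of_lt R L m y htR hvr]
    by_cases hb : preLetter R L m y (vrank R t) = true
    · rw [if_pos ⟨htR, hb⟩, if_pos hb]
    · rw [if_neg (fun h => hb h.2), if_neg hb]

/-- The height at the tail start from the height formula: `Σ_{i<2jE} ±[preLetter i] − #(R ∩ [0,E′))`. [folklore] -/
theorem tailHeight_eq_sum :
    tailHeight R L m y
      = (∑ i ∈ range (2 * tailPairs R L m), (if preLetter R L m y i = true then (1 : ℤ) else -1))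
        - ((R.filter fun i : Fin N => i.val < tailStart R L m).card : ℤ) := by
  rw [tailHeight_eq, height_eq R L m y _ (tailStart_le R L m), vrank_tailStart, min_self, Nat.sub_self,
    sum_range_zero, add_zero]

/-- The number of tail non-defect positions is `T_V = #Rᶜ − 2·jE`: the non-defect positions `≥ E′`. [folklore] -/
theorem card_compl_filter_tailStart_le :
    (Rᶜ.filter fun i : Fin N => tailStart R L m ≤ i.val).card = Rᶜ.card - 2 * tailPairs R L m := by
  have h := card_filter_add_card_filter_not (s := Rᶜ) (fun i : Fin N => i.val < tailStart R L m)
  have h1 : (Rᶜ.filter fun i : Fin N => i.val < tailStart R L m).card = 2 * tailPairs R L m :=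
    vrank_tailStart R L m
  have h2 : (Rᶜ.filter fun i : Fin N => ¬ i.val < tailStart R L m) = Rᶜ.filter fun i : Fin N => tailStart R L m ≤ i.val := by
    congr 1; ext i; simp only [not_lt]
  rw [h2, h1] at h
  omega

/-- Counting all positions from the tail start: `T_V + #(R ∩ [E′,N)) = N − E′`. [folklore] -/
theorem card_tail_positions :
    (Rᶜ.card - 2 * tailPairs R L m) + (R.filter fun i : Fin N => tailStart R L m ≤ i.val).card
      = N - tailStart R L m := by
  classical
  rw [← card_compl_filter_tailStart_le R L m]
  have hu : (Rᶜ.filter fun i : Fin N => tailStart R L m ≤ i.val) ∪ (R.filter fun i : Fin N => tailStart R L m ≤ i.val)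
      = (univ : Finset (Fin N)).filter fun i : Fin N => tailStart R L m ≤ i.val := by
    ext i; simp only [mem_union, mem_filter, mem_compl, mem_univ, true_and]; tauto
  have hd : Disjoint (Rᶜ.filter fun i : Fin N => tailStart R L m ≤ i.val)
      (R.filter fun i : Fin N => tailStart R L m ≤ i.val) := by
    rw [disjoint_left]; intro i h1 h2
    exact (mem_compl.1 (mem_filter.1 h1).1) (mem_filter.1 h2).1
  rw [← card_union_of_disjoint hd, hu]
  -- `#{i : E′ ≤ i} = N − E′`
  have h := card_filter_add_card_filter_not (s := (univ : Finset (Fin N)))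
    (fun i : Fin N => i.val < tailStart R L m)
  rw [card_univ, Fintype.card_fin, card_univ_filter_lt (tailStart_le R L m)] at h
  have h2 : ((univ : Finset (Fin N)).filter fun i : Fin N => ¬ i.val < tailStart R L m)
      = (univ : Finset (Fin N)).filter fun i : Fin N => tailStart R L m ≤ i.val := by
    congr 1; ext i; simp only [not_lt]
  rw [h2] at h
  omega

/-- Positions below `u` split into non-defect and defect ones: `vrank u + #(R ∩ [0,u)) = u` (`u ≤ N`). [folklore] -/
theorem vrank_add_card_lt (u : ℕ) (hu : u ≤ N) :
    vrank R u + (R.filter fun i : Fin N => i.val < u).card = u := by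
  classical
  unfold vrank
  have hu' : (Rᶜ.filter fun i : Fin N => (i : ℕ) < u) ∪ (R.filter fun i : Fin N => i.val < u)
      = (univ : Finset (Fin N)).filter fun i : Fin N => i.val < u := by
    ext i; simp only [mem_union, mem_filter, mem_compl, mem_univ, true_and]; tauto
  have hd : Disjoint (Rᶜ.filter fun i : Fin N => (i : ℕ) < u) (R.filter fun i : Fin N => i.val < u) := by
    rw [disjoint_left]; intro i h1 h2
    exact (mem_compl.1 (mem_filter.1 h1).1) (mem_filter.1 h2).1
  rw [← card_union_of_disjoint hd, hu', card_univ_filter_lt hu]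

/-- The tail sum: `Σ_{i<T} ±[i < k] = 2k − T` for `k ≤ T`. [folklore] -/
theorem sum_range_ite_lt (k T : ℕ) (hk : k ≤ T) :
    (∑ i ∈ range T, (if i < k then (1 : ℤ) else -1)) = 2 * (k : ℤ) - T := by
  induction T with
  | zero => simp at hk; subst hk; simp
  | succ T ih =>
    rcases Nat.lt_or_ge T k with h | h
    · -- then `k = T + 1`
      have hk' : k = T + 1 := by omega
      subst hk'
      rw [sum_range_succ, if_pos (Nat.lt_succ_self T)]
      have : (∑ i ∈ range T, (if i < T + 1 then (1 : ℤ) else -1)) = ∑ i ∈ range T, (1 : ℤ) :=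
        sum_congr rfl fun i hi => by rw [mem_range] at hi; rw [if_pos (by omega)]
      rw [this, sum_const, card_range]; simp; ring
    · rw [sum_range_succ, if_neg (by omega), ih h]; push_cast; ring

/-- The tail sum in the push phase: `Σ_{i<T} ±[i < k] = T` for `T ≤ k`. [folklore] -/
theorem sum_range_ite_lt_of_le (k T : ℕ) (hk : T ≤ k) :
    (∑ i ∈ range T, (if i < k then (1 : ℤ) else -1)) = T := by
  have : (∑ i ∈ range T, (if i < k then (1 : ℤ) else -1)) = ∑ i ∈ range T, (1 : ℤ) :=
    sum_congr rfl fun i hi => by rw [mem_range] at hi; rw [if_pos (by omega)]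
  rw [this, sum_const, card_range]; simp

/-- The defects split at the tail start. [folklore] -/
theorem card_R_split :
    R.card = (R.filter fun i : Fin N => i.val < tailStart R L m).card
      + (R.filter fun i : Fin N => tailStart R L m ≤ i.val).card := by
  rw [← card_filter_add_card_filter_not (s := R) (fun i : Fin N => i.val < tailStart R L m)]
  congr 2; ext i; simp only [not_lt]

/-- **The drain count (S5).**  If `N` is even and `#(R ∩ [E′,N)) ≤ h(E′) ≤ T_V + #(R ∩ [E′,N))`, then
`2·tailPushes = T_V + #(R ∩ [E′,N)) − h(E′)` and `tailPushes ≤ T_V`. [folklore] -/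
theorem two_mul_tailPushes_eq (hN : Even N)
    (h1 : ((R.filter fun i : Fin N => tailStart R L m ≤ i.val).card : ℤ) ≤ tailHeight R L m y)
    (h2 : tailHeight R L m y ≤ ((Rᶜ.card - 2 * tailPairs R L m : ℕ) : ℤ)
      + ((R.filter fun i : Fin N => tailStart R L m ≤ i.val).card : ℤ)) :
    2 * (tailPushes R L m y : ℤ) = ((Rᶜ.card - 2 * tailPairs R L m : ℕ) : ℤ)
        + ((R.filter fun i : Fin N => tailStart R L m ≤ i.val).card : ℤ) - tailHeight R L m y ∧
      tailPushes R L m y ≤ Rᶜ.card - 2 * tailPairs R L m := by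
  -- parity: `h(E′) ≡ E′` and `T_V + #R_tail = N − E′`
  have hpar := card_openers_lt_add (inflateWord R L m y) _ (tailStart_le R L m)
  have hth := tailHeight_eq R L m y
  have hpos := card_tail_positions R L m
  have hEN := tailStart_le R L m
  obtain ⟨n', hn'⟩ := hN
  set D : ℤ := ((Rᶜ.card - 2 * tailPairs R L m : ℕ) : ℤ)
      + ((R.filter fun i : Fin N => tailStart R L m ≤ i.val).card : ℤ) - tailHeight R L m y with hD
  have hD0 : 0 ≤ D := by rw [hD]; linarith
  -- `D` is even
  have hDeven : ∃ q : ℕ, D = 2 * (q : ℤ) := by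
    have e1 : D + tailHeight R L m y = ((N - tailStart R L m : ℕ) : ℤ) := by
      rw [hD, ← hpos]; push_cast; ring
    have e2 : tailHeight R L m y + 2 * (((closerSet (inflateWord R L m y)).filter
        fun i => i.val < tailStart R L m).card : ℤ) = (tailStart R L m : ℤ) := by
      rw [hth]
      have h := congrArg (fun k : ℕ => (k : ℤ)) hpar
      push_cast at h
      linarith
    have e3 : D = (N : ℤ) - 2 * (tailStart R L m : ℤ) + 2 * (((closerSet (inflateWord R L m y)).filter
        fun i => i.val < tailStart R L m).card : ℤ) := by
      have : ((N - tailStart R L m : ℕ) : ℤ) = (N : ℤ) - tailStart R L m := by push_cast [Nat.cast_sub hEN]; ring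
      linarith
    refine ⟨(D / 2).toNat, ?_⟩
    have hDmod : D % 2 = 0 := by rw [e3]; omega
    have hq : 0 ≤ D / 2 := by omega
    rw [Int.toNat_of_nonneg hq]; omega
  obtain ⟨q, hq⟩ := hDeven
  have htp : tailPushes R L m y = q := by
    unfold tailPushes
    rw [show (((Rᶜ.card - 2 * tailPairs R L m : ℕ) : ℤ)
        + ((R.filter fun i : Fin N => tailStart R L m ≤ (i : ℕ)).card : ℤ) - tailHeight R L m y) = D from rfl, hq]
    rw [show (2 * (q : ℤ)) = ((2 * q : ℕ) : ℤ) by push_cast; ring, Int.toNat_natCast]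
    omega
  refine ⟨by rw [htp, ← hq], ?_⟩
  rw [htp]
  have : 2 * (q : ℤ) ≤ 2 * ((Rᶜ.card - 2 * tailPairs R L m : ℕ) : ℤ) := by rw [← hq, hD]; linarith
  exact_mod_cast (by linarith : (q : ℤ) ≤ ((Rᶜ.card - 2 * tailPairs R L m : ℕ) : ℤ))

/-- **Balance**: under the drain hypotheses the inflated word has as many closers as openers (its FIFO pairing is
defined). [folklore] -/
theorem balanced_inflateWord (hN : Even N)
    (h1 : ((R.filter fun i : Fin N => tailStart R L m ≤ i.val).card : ℤ) ≤ tailHeight R L m y)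
    (h2 : tailHeight R L m y ≤ ((Rᶜ.card - 2 * tailPairs R L m : ℕ) : ℤ)
      + ((R.filter fun i : Fin N => tailStart R L m ≤ i.val).card : ℤ)) :
    (closerSet (inflateWord R L m y)).card = (openerSet (inflateWord R L m y)).card := by
  obtain ⟨hk, hkle⟩ := two_mul_tailPushes_eq R L m y hN h1 h2
  have hH := height_eq R L m y N le_rfl
  rw [card_filter_lt_of_le _ le_rfl, card_filter_lt_of_le _ le_rfl, card_filter_lt_of_le _ le_rfl,
    vrank_of_le R le_rfl, min_eq_right (two_mul_tailPairs_le R L m),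
    sum_range_ite_lt _ _ hkle] at hH
  have hsplit := congrArg (fun k : ℕ => (k : ℤ)) (card_R_split R L m)
  push_cast at hsplit
  have hth := tailHeight_eq_sum R L m y
  have hTV : (((Rᶜ.card - 2 * tailPairs R L m : ℕ) : ℤ)) = (Rᶜ.card : ℤ) - 2 * (tailPairs R L m : ℤ) := by
    push_cast [Nat.cast_sub (two_mul_tailPairs_le R L m)]; ring
  rw [hTV] at hk hH
  have : ((openerSet (inflateWord R L m y)).card : ℤ) - ((closerSet (inflateWord R L m y)).card : ℤ) = 0 := by
    rw [hH]; linarith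
  exact_mod_cast (by linarith : ((closerSet (inflateWord R L m y)).card : ℤ) = (openerSet (inflateWord R L m y)).card)

/-- The V-rank of the head end `A = vpos (2·jA)` is `2·jA`. [folklore] -/
theorem vrank_headEnd : vrank R (vpos R (2 * headPairs R L m)) = 2 * headPairs R L m := by
  rcases (le_trans (Nat.mul_le_mul_left 2 (headPairs_le R L m)) (two_mul_tailPairs_le R L m)).eq_or_lt with h | h
  · rw [vpos_of_le R h.ge, vrank_of_le R le_rfl, h]
  · exact vrank_vpos R h

/-- **The prefix property (⇒ ballot).**  If `N` is even, the drain hypotheses hold, the head satisfies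
`2·#(R ∩ [0,u)) ≤ u` for `u ≤ A` (SPEC S0), and on the middle `[A, E′]` the prefixes have at least as many openers
as closers (what the Band gives: `h ≥ H − m ≥ L − m ≥ 0`), then EVERY prefix of the inflated word has at least as
many openers as closers. [folklore] -/
theorem prefix_le_inflateWord (hN : Even N)
    (h1 : ((R.filter fun i : Fin N => tailStart R L m ≤ i.val).card : ℤ) ≤ tailHeight R L m y)
    (h2 : tailHeight R L m y ≤ ((Rᶜ.card - 2 * tailPairs R L m : ℕ) : ℤ)
      + ((R.filter fun i : Fin N => tailStart R L m ≤ i.val).card : ℤ))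
    (hhead : ∀ u : ℕ, u ≤ vpos R (2 * headPairs R L m) → 2 * (R.filter fun i : Fin N => i.val < u).card ≤ u)
    (hmid : ∀ u : ℕ, vpos R (2 * headPairs R L m) ≤ u → u ≤ tailStart R L m →
      ((closerSet (inflateWord R L m y)).filter fun i => i.val < u).card
        ≤ ((openerSet (inflateWord R L m y)).filter fun i => i.val < u).card)
    (u : ℕ) :
    ((closerSet (inflateWord R L m y)).filter fun i => i.val < u).card
      ≤ ((openerSet (inflateWord R L m y)).filter fun i => i.val < u).card := by
  have hbal := balanced_inflateWord R L m y hN h1 h2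
  obtain ⟨hk, hkle⟩ := two_mul_tailPushes_eq R L m y hN h1 h2
  by_cases huN : N ≤ u
  · rw [card_filter_lt_of_le _ huN, card_filter_lt_of_le _ huN, hbal]
  rw [not_le] at huN
  by_cases huA : u ≤ vpos R (2 * headPairs R L m)
  · -- head: all non-defect letters push
    have hH := height_eq R L m y u huN.le
    have hvr : vrank R u ≤ 2 * headPairs R L m := by
      have := vrank_mono R huA; rwa [vrank_headEnd] at this
    have hjE := headPairs_le R L m
    rw [min_eq_left (by omega), Nat.sub_eq_zero_of_le (by omega), sum_range_zero, add_zero] at hH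
    have hsum : (∑ i ∈ range (vrank R u), (if preLetter R L m y i = true then (1 : ℤ) else -1)) = vrank R u := by
      have hall : ∀ i ∈ range (vrank R u), (if preLetter R L m y i = true then (1 : ℤ) else -1) = 1 := by
        intro i hi
        rw [mem_range] at hi
        rw [if_pos (preLetter_of_lt R L m y (by omega))]
      rw [sum_congr rfl hall, sum_const, card_range]; simp
    rw [hsum] at hH
    have hsplit := vrank_add_card_lt R u huN.le
    have hh := hhead u huA
    have : (0 : ℤ) ≤ (((openerSet (inflateWord R L m y)).filter fun i => i.val < u).card : ℤ)
        - (((closerSet (inflateWord R L m y)).filter fun i => i.val < u).card : ℤ) := by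
      rw [hH]; omega
    exact_mod_cast (by linarith : (((closerSet (inflateWord R L m y)).filter fun i => i.val < u).card : ℤ)
      ≤ (((openerSet (inflateWord R L m y)).filter fun i => i.val < u).card : ℤ))
  rw [not_le] at huA
  by_cases huE : u ≤ tailStart R L m
  · exact hmid u huA.le huE
  rw [not_le] at huE
  -- tail: compare with the height at `E′` and at `N`
  have hH := height_eq R L m y u huN.le
  have hHN := height_eq R L m y N le_rfl
  have hvE : 2 * tailPairs R L m ≤ vrank R u := by
    have := vrank_mono R huE.le; rwa [vrank_tailStart] at this
  rw [min_eq_right hvE] at hH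
  rw [card_filter_lt_of_le _ le_rfl, card_filter_lt_of_le _ le_rfl, card_filter_lt_of_le _ le_rfl,
    vrank_of_le R le_rfl, min_eq_right (two_mul_tailPairs_le R L m), sum_range_ite_lt _ _ hkle, hbal, sub_self] at hHN
  have hth := tailHeight_eq_sum R L m y
  -- the defects below `u` split at `E′`
  have hRu : (R.filter fun i : Fin N => i.val < u).card
      = (R.filter fun i : Fin N => i.val < tailStart R L m).card
        + (R.filter fun i : Fin N => tailStart R L m ≤ i.val ∧ i.val < u).card := by
    rw [card_filter_lt_eq_Ico, card_filter_lt_eq_Ico R (tailStart R L m)]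
    exact card_filter_Ico_split R (Nat.zero_le _) huE.le
  have hRwin : (R.filter fun i : Fin N => tailStart R L m ≤ i.val ∧ i.val < u).card
      ≤ (R.filter fun i : Fin N => tailStart R L m ≤ i.val).card :=
    card_le_card (fun i hi => by rw [mem_filter] at hi ⊢; exact ⟨hi.1, hi.2.1⟩)
  have hRle : (R.filter fun i : Fin N => i.val < u).card ≤ R.card := card_filter_le _ _
  have hvle : vrank R u ≤ Rᶜ.card := vrank_le_card R u
  have hTV : (((Rᶜ.card - 2 * tailPairs R L m : ℕ) : ℤ)) = (Rᶜ.card : ℤ) - 2 * (tailPairs R L m : ℤ) := by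
    push_cast [Nat.cast_sub (two_mul_tailPairs_le R L m)]; ring
  rw [hTV] at hk hHN h2
  have hRu' : ((R.filter fun i : Fin N => i.val < u).card : ℤ)
      = ((R.filter fun i : Fin N => i.val < tailStart R L m).card : ℤ)
        + ((R.filter fun i : Fin N => tailStart R L m ≤ i.val ∧ i.val < u).card : ℤ) := by exact_mod_cast hRu
  have hRwin' : ((R.filter fun i : Fin N => tailStart R L m ≤ i.val ∧ i.val < u).card : ℤ)
      ≤ ((R.filter fun i : Fin N => tailStart R L m ≤ i.val).card : ℤ) := by exact_mod_cast hRwin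
  have hRle' : ((R.filter fun i : Fin N => i.val < u).card : ℤ) ≤ (R.card : ℤ) := by exact_mod_cast hRle
  have hvle' : (vrank R u : ℤ) ≤ (Rᶜ.card : ℤ) := by exact_mod_cast hvle
  have hvE' : (2 * tailPairs R L m : ℤ) ≤ (vrank R u : ℤ) := by exact_mod_cast hvE
  have key : (0 : ℤ) ≤ (((openerSet (inflateWord R L m y)).filter fun i => i.val < u).card : ℤ)
      - (((closerSet (inflateWord R L m y)).filter fun i => i.val < u).card : ℤ) := by
    rw [hH]
    by_cases hphase : vrank R u - 2 * tailPairs R L m ≤ tailPushes R L m y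
    · -- push phase
      rw [sum_range_ite_lt_of_le _ _ hphase]
      push_cast [Nat.cast_sub hvE]
      linarith
    · -- pop phase
      rw [not_le] at hphase
      rw [sum_range_ite_lt _ _ hphase.le]
      push_cast [Nat.cast_sub hvE]
      linarith
  exact_mod_cast (by linarith : (((closerSet (inflateWord R L m y)).filter fun i => i.val < u).card : ℤ)
    ≤ (((openerSet (inflateWord R L m y)).filter fun i => i.val < u).card : ℤ))

/-- **The inflated word is a ballot word** under the hypotheses of `prefix_le_inflateWord`; hence its FIFO pairing is
a nest-free perfect matching (`fifo_mem_nestFreeMatchings`) avoiding `R × R` (`fifo_inflateWord_not_mem`). [folklore] -/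
theorem isBallot_inflateWord (hN : Even N)
    (h1 : ((R.filter fun i : Fin N => tailStart R L m ≤ i.val).card : ℤ) ≤ tailHeight R L m y)
    (h2 : tailHeight R L m y ≤ ((Rᶜ.card - 2 * tailPairs R L m : ℕ) : ℤ)
      + ((R.filter fun i : Fin N => tailStart R L m ≤ i.val).card : ℤ))
    (hhead : ∀ u : ℕ, u ≤ vpos R (2 * headPairs R L m) → 2 * (R.filter fun i : Fin N => i.val < u).card ≤ u)
    (hmid : ∀ u : ℕ, vpos R (2 * headPairs R L m) ≤ u → u ≤ tailStart R L m →
      ((closerSet (inflateWord R L m y)).filter fun i => i.val < u).card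
        ≤ ((openerSet (inflateWord R L m y)).filter fun i => i.val < u).card) :
    IsBallot (inflateWord R L m y) (balanced_inflateWord R L m y hN h1 h2) :=
  isBallot_of_prefix_le _ (prefix_le_inflateWord R L m y hN h1 h2 hhead hmid)

/-- **The measure's support**: under the same hypotheses the FIFO pairing of the inflated word is a nest-free perfect
matching of `Fin N` that avoids `R × R` (SPEC S1/S6: supp μ ⊆ 𝓕_R). [folklore] -/
theorem fifo_inflateWord_mem (hN : Even N)
    (h1 : ((R.filter fun i : Fin N => tailStart R L m ≤ i.val).card : ℤ) ≤ tailHeight R L m y)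
    (h2 : tailHeight R L m y ≤ ((Rᶜ.card - 2 * tailPairs R L m : ℕ) : ℤ)
      + ((R.filter fun i : Fin N => tailStart R L m ≤ i.val).card : ℤ))
    (hhead : ∀ u : ℕ, u ≤ vpos R (2 * headPairs R L m) → 2 * (R.filter fun i : Fin N => i.val < u).card ≤ u)
    (hmid : ∀ u : ℕ, vpos R (2 * headPairs R L m) ≤ u → u ≤ tailStart R L m →
      ((closerSet (inflateWord R L m y)).filter fun i => i.val < u).card
        ≤ ((openerSet (inflateWord R L m y)).filter fun i => i.val < u).card) :
    fifo (inflateWord R L m y) (balanced_inflateWord R L m y hN h1 h2) ∈ nestFreeMatchings N ∧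
      ∀ i ∈ R, fifo (inflateWord R L m y) (balanced_inflateWord R L m y hN h1 h2) i ∉ R :=
  ⟨fifo_mem_nestFreeMatchings (isBallot_inflateWord R L m y hN h1 h2 hhead hmid),
    fun _ hi => fifo_inflateWord_not_mem R L m y _ hi⟩

end Inflate

end Summit.ValiantsHypothesis.ValiantsHypothesis.Theorems.FifoMatching.NNLinearDegreeCofactorHard.InflateWord

end
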